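import Literature.NumberTheory.LFunctions.FordIncompleteS4
import HarnessLib

/-!
# Ford's Lemma 4.1 (incomplete systems over smooth numbers), with `r = h`

Topic `Literature/NumberTheory/LFunctions`. Everything here is PROVED.

K. Ford, Proc. LMS 85 (2002), **Lemma 4.1** (the "fundamental lemma" for `J_{s,k,h}(𝒞(P,R))`),
in the case `r = h` used by Lemma 4.2, with the prime-number and prime-sum inputs of this library
(Chebyshev–Sylvester constants) and with the constant `(tk)^t` in place of `k^t` for the diagonal
count (we also count singular heads, see `FordIncompleteJt`). Precisely, for `h + t = k + 1`,
`m = s - t ≥ 1`, `R = P^η`, `√R > k`, `|𝒞(P,R)| ≥ 64 t⁴`: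

`J_{s,k,h}(𝒞(P,R)) ≤ max [ T₁, T₂ ]`, where
`T₁ = ((16m/3)² 4^{N₀} (t(t+1))^{N₀} e^{1/η} P^{1/h} |𝒞|)^m (tk)^t |𝒞|^t` (Ford: `((8s)²(22t²)^{2/η}P^{1/r})^{s-t} k^t |𝒞|^s`),
`T₂ = (8/3) (k^t)^{N₁} |𝒞|^t (∑_{q ∈ (Q, Q⌊R⌋], p ∣ q ⇒ p > √R} J_{m,k,h}(𝒞(P/q,R))^{1/2m})^{2m}`
(Ford: `4 k^{2t(1+1/(hη))} |𝒞|^t (∑_{P^{1/h} < q ≤ P^{1/h}R} J_{s-t,k,h}(𝒞(P/q,R))^{1/(2s-2t)})^{2s-2t}`),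
`N₀ = ⌊2/η⌋`, `N₁ = ⌊2/(hη) + 2⌋`.

The proof: classes `S₂` (coincidence in a head; `FordIncompleteSetup`), `S₃` (a special rest
variable; `FordIncompleteS3*`), `S₄` (the rest; `FordIncompleteS4*`). Ford's class `S₁` is not
needed.

## References

* K. Ford, Proc. London Math. Soc. (3) 85 (2002), 565–633, Lemma 4.1 and its proof. [Ford2002]
-/

noncomputable section

open Finset MeasureTheory ArithmeticFunction
open scoped Real ArithmeticFunction.Omega

namespace Literature.NumberTheory.LFunctions
namespace FordVK

open VMV FordSmooth

section Assembly

variable {k h t m : ℕ}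

/-- **A head coincidence at the level of `SolS`** is bounded by `J^{1-1/(2s)}`.
[cite: Ford2002, proof of Lemma 4.1 (case S₂)] -/
theorem card_SolS_head_coincidence_le (B : Finset ℤ) (a b : Fin t) (hab : a ≠ b) :
    (((SolS k h k t m B).filter fun p => p.1.1 a = p.1.1 b).card : ℝ)
      ≤ (Jinc k (t + m) B h k : ℝ) ^ (1 - 1 / (2 * ((t + m : ℕ) : ℝ))) := by
  have hcard : ((SolS k h k t m B).filter fun p => p.1.1 a = p.1.1 b).card
      = (((tuples (t + m) B) ×ˢ (tuples (t + m) B)).filter fun p =>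
          psvR k h k p.1 = psvR k h k p.2 ∧ p.1 (Fin.castAdd m a) = p.1 (Fin.castAdd m b)).card := by
    refine card_equiv ((Fin.appendEquiv t m).prodCongr (Fin.appendEquiv t m)) fun p => ?_
    rw [mem_filter, mem_SolS, mem_filter, mem_product, Equiv.prodCongr_apply, Prod.map_fst, Prod.map_snd]
    have e1 : (Fin.appendEquiv t m) p.1 = Fin.append p.1.1 p.1.2 := rfl
    have e2 : (Fin.appendEquiv t m) p.2 = Fin.append p.2.1 p.2.2 := rfl
    rw [e1, e2, append_mem_tuples, append_mem_tuples, psvR_append, psvR_append, Fin.append_left,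
      Fin.append_left]
    tauto
  rw [hcard]
  have hab' : Fin.castAdd m a ≠ Fin.castAdd m b := fun hh' => hab (Fin.castAdd_injective _ _ hh')
  exact card_coincidence_le B _ _ hab'

/-- **The class `S₂` is small**: `#{¬(x, y heads injective)} ≤ 2t² J^{1-1/(2s)}`.
[cite: Ford2002, proof of Lemma 4.1 ("S₀ ≤ 4S₂ ≤ 8 binom(t,2) ∫ |f^{2s-2} f(2α)| … = 4t² S₀^{1-1/2s}")] -/
theorem card_Sol2_le (B : Finset ℤ) :
    (((SolS k h k t m B).filter fun p =>
        ¬ (Function.Injective p.1.1 ∧ Function.Injective p.2.1)).card : ℝ)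
      ≤ 2 * (t : ℝ) ^ 2 * (Jinc k (t + m) B h k : ℝ) ^ (1 - 1 / (2 * ((t + m : ℕ) : ℝ))) := by
  classical
  set J : ℝ := (Jinc k (t + m) B h k : ℝ) ^ (1 - 1 / (2 * ((t + m : ℕ) : ℝ))) with hJ
  set A : Fin t × Fin t → Finset _ := fun ab => (SolS k h k t m B).filter fun p => p.1.1 ab.1 = p.1.1 ab.2
    with hA
  set Bs : Fin t × Fin t → Finset _ := fun ab => (SolS k h k t m B).filter fun p => p.2.1 ab.1 = p.2.1 ab.2
    with hBs
  set Pairs := (univ : Finset (Fin t × Fin t)).filter fun ab => ab.1 ≠ ab.2 with hPairs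
  have hsub : ((SolS k h k t m B).filter fun p =>
      ¬ (Function.Injective p.1.1 ∧ Function.Injective p.2.1)) ⊆ Pairs.biUnion fun ab => A ab ∪ Bs ab := by
    intro p hp
    rw [mem_filter] at hp
    obtain ⟨hsol, hnot⟩ := hp
    rw [mem_biUnion]
    rcases not_and_or.1 hnot with hx | hy
    · obtain ⟨a, b, hfab, hab⟩ := Function.not_injective_iff.1 hx
      refine ⟨(a, b), by rw [hPairs, mem_filter]; exact ⟨mem_univ _, hab⟩, ?_⟩
      rw [mem_union]; left; rw [hA, mem_filter]; exact ⟨hsol, hfab⟩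
    · obtain ⟨a, b, hfab, hab⟩ := Function.not_injective_iff.1 hy
      refine ⟨(a, b), by rw [hPairs, mem_filter]; exact ⟨mem_univ _, hab⟩, ?_⟩
      rw [mem_union]; right; rw [hBs, mem_filter]; exact ⟨hsol, hfab⟩
  have hAle : ∀ ab ∈ Pairs, ((A ab).card : ℝ) ≤ J := by
    intro ab hab
    rw [hPairs, mem_filter] at hab
    exact card_SolS_head_coincidence_le B ab.1 ab.2 hab.2
  have hBA : ∀ ab, (Bs ab).card = (A ab).card := by
    intro ab
    have := card_SolS_filter_swap (k := k) (h := h) (g := k) (t := t) (m := m) (B := B)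
      (fun p => p.1.1 ab.1 = p.1.1 ab.2)
    simp only [hA, hBs]
    exact this
  have hPcard : (Pairs.card : ℝ) ≤ (t : ℝ) ^ 2 := by
    have : Pairs.card ≤ (univ : Finset (Fin t × Fin t)).card := card_filter_le _ _
    rw [card_univ, Fintype.card_prod, Fintype.card_fin] at this
    calc (Pairs.card : ℝ) ≤ ((t * t : ℕ) : ℝ) := by exact_mod_cast this
      _ = (t : ℝ) ^ 2 := by push_cast; ring
  have hJ0 : 0 ≤ J := Real.rpow_nonneg (Nat.cast_nonneg _) _
  calc (((SolS k h k t m B).filter fun p =>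
          ¬ (Function.Injective p.1.1 ∧ Function.Injective p.2.1)).card : ℝ)
      ≤ ((Pairs.biUnion fun ab => A ab ∪ Bs ab).card : ℝ) := by exact_mod_cast card_le_card hsub
    _ ≤ ∑ ab ∈ Pairs, (((A ab ∪ Bs ab).card : ℕ) : ℝ) := by exact_mod_cast card_biUnion_le
    _ ≤ ∑ ab ∈ Pairs, 2 * J := by
        refine sum_le_sum fun ab hab => ?_
        calc (((A ab ∪ Bs ab).card : ℕ) : ℝ) ≤ (((A ab).card + (Bs ab).card : ℕ) : ℝ) := by
              exact_mod_cast card_union_le _ _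
          _ = 2 * ((A ab).card : ℝ) := by rw [hBA ab]; push_cast; ring
          _ ≤ 2 * J := by linarith [hAle ab hab]
    _ = Pairs.card * (2 * J) := by rw [sum_const, nsmul_eq_mul]
    _ ≤ (t : ℝ) ^ 2 * (2 * J) := mul_le_mul_of_nonneg_right hPcard (by positivity)
    _ = 2 * (t : ℝ) ^ 2 * J := by ring

/-- The three classes cover the solution set. [cite: Ford2002, proof of Lemma 4.1 ("Evidently
S₀ ≤ 4 max(S₁, S₂, S₃, S₄)")] -/
theorem card_SolS_le_three {m' : ℕ} (B : Finset ℤ) (Qn : ℕ) :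
    (SolS k h k t (m' + 1) B).card
      ≤ ((SolS k h k t (m' + 1) B).filter fun p =>
            ¬ (Function.Injective p.1.1 ∧ Function.Injective p.2.1)).card
        + (SolSp k h k t m' B Qn).card + (SolS4 k h t (m' + 1) B Qn).card := by
  classical
  have hsub : SolS k h k t (m' + 1) B ⊆
      ((SolS k h k t (m' + 1) B).filter fun p => ¬ (Function.Injective p.1.1 ∧ Function.Injective p.2.1))
        ∪ (SolSp k h k t m' B Qn ∪ SolS4 k h t (m' + 1) B Qn) := by
    intro p hp
    rw [mem_union, mem_union]
    by_cases hinj : Function.Injective p.1.1 ∧ Function.Injective p.2.1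
    · right
      by_cases hsp : ∃ i : Fin (m' + 1), Special Qn (JN p.1.1) (p.1.2 i).natAbs ∨ Special Qn (JN p.2.1) (p.2.2 i).natAbs
      · left; rw [SolSp, mem_filter]; exact ⟨hp, hinj.1, hinj.2, hsp⟩
      · right; rw [SolS4, mem_filter]
        push Not at hsp
        exact ⟨hp, hinj.1, hinj.2, hsp⟩
    · left; rw [mem_filter]; exact ⟨hp, hinj⟩
  calc (SolS k h k t (m' + 1) B).card ≤ _ := card_le_card hsub
    _ ≤ _ := card_union_le _ _
    _ ≤ _ := Nat.add_le_add_left (card_union_le _ _) _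
    _ = _ := by ring

/-- **`ω(q) ≤ N₁ = ⌊2/(hη) + 2⌋`** for `q ∈ Qrange` (`q ≤ P^{1/h} R`, all primes `> √R = P^{η/2}`).
[cite: Ford2002, proof of Lemma 4.1 ("Since ω(q) ≤ 2/(rη) + 2")] -/
theorem card_primeFactors_le_of_mem_Qrange {P R η : ℝ} (hP : 1 ≤ P) (hη : 0 < η) (hR : R = P ^ η)
    (hh : 1 ≤ h) {q : ℕ} (hq : q ∈ Qrange R ⌊P ^ (1 / (h : ℝ))⌋₊) :
    q.primeFactors.card ≤ ⌊2 / ((h : ℝ) * η) + 2⌋₊ := by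
  rw [mem_Qrange] at hq
  obtain ⟨⟨hQq, hqQR⟩, hpf⟩ := hq
  have hP0 : 0 < P := by linarith
  have hh0 : (0 : ℝ) < h := by exact_mod_cast hh
  have hq0 : q ≠ 0 := by omega
  refine (card_primeFactors_le_cardFactors q).trans (Nat.le_floor ?_)
  -- `(√R)^{Ω q} ≤ q ≤ P^{1/h} R`
  have h1 : (Real.sqrt R) ^ (Ω q) ≤ q := pow_cardFactors_le hq0 (Real.sqrt_nonneg _) fun p hp => (hpf p hp).le
  have hsqrt : Real.sqrt R = P ^ (η / 2) := by
    rw [hR, Real.sqrt_eq_rpow, ← Real.rpow_mul hP0.le]; ring_nf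
  have hQ0 : 0 ≤ P ^ (1 / (h : ℝ)) := Real.rpow_nonneg hP0.le _
  have hR0 : 0 ≤ R := by rw [hR]; exact Real.rpow_nonneg hP0.le _
  have h2 : (q : ℝ) ≤ P ^ (1 / (h : ℝ)) * R := by
    calc (q : ℝ) ≤ ((⌊P ^ (1 / (h : ℝ))⌋₊ * ⌊R⌋₊ : ℕ) : ℝ) := by exact_mod_cast hqQR
      _ = (⌊P ^ (1 / (h : ℝ))⌋₊ : ℝ) * ⌊R⌋₊ := by push_cast; ring
      _ ≤ P ^ (1 / (h : ℝ)) * R := mul_le_mul (Nat.floor_le hQ0) (Nat.floor_le hR0) (Nat.cast_nonneg _) hQ0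
  rw [hsqrt, ← Real.rpow_natCast, ← Real.rpow_mul hP0.le] at h1
  rw [hR, ← Real.rpow_add hP0] at h2
  have h3 : P ^ (η / 2 * (Ω q : ℕ)) ≤ P ^ (1 / (h : ℝ) + η) := h1.trans h2
  rcases hP.eq_or_lt with hP1 | hP1
  · -- `P = 1`: then `q ≤ 1 < q`, contradiction
    exfalso
    have hQ : P ^ (1 / (h : ℝ)) = 1 := by rw [← hP1, Real.one_rpow]
    have hR1 : R = 1 := by rw [hR, ← hP1, Real.one_rpow]
    rw [hQ] at hQq hqQR
    rw [hR1] at hqQR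
    simp at hQq hqQR
    omega
  · have h4 := (Real.rpow_le_rpow_left_iff hP1).1 h3
    calc ((Ω q : ℕ) : ℝ) = (η / 2 * (Ω q : ℕ)) * (2 / η) := by field_simp
      _ ≤ (1 / (h : ℝ) + η) * (2 / η) := mul_le_mul_of_nonneg_right h4 (by positivity)
      _ = 2 / ((h : ℝ) * η) + 2 := by field_simp

/-- **Ford's Lemma 4.1** (with `r = h`; prime inputs and diagonal constant of this library).
Hypotheses: `h ≥ 1`, `t ≥ 1`, `h + t = k + 1`, `m = s − t ≥ 1`, `P ≥ 1`, `R = P^η` with `√R > k`,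
`|𝒞(P,R)| ≥ 64 t⁴`. Conclusion: `J_{t+m,k,h}(𝒞(P,R)) ≤ max(T₁, T₂)` with `T₁, T₂` as in the module
docstring. [cite: Ford2002, Lemma 4.1] -/
theorem ford_lemma41 {m' : ℕ} (hh : 1 ≤ h) (ht : 1 ≤ t) (hk : h + t = k + 1)
    {P R η : ℝ} (hP : 1 ≤ P) (hη : 0 < η) (hR : R = P ^ η) (hkR : (k : ℝ) < Real.sqrt R)
    (hC : (64 : ℝ) * (t : ℝ) ^ 4 ≤ ((smoothSet P R).card : ℝ)) :
    (Jinc k (t + (m' + 1)) ((smoothSet P R).map Nat.castEmbedding) h k : ℝ) ≤ max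
      ((((16 : ℝ) * (m' + 1) / 3) ^ 2 * (4 : ℝ) ^ ⌊2 / η⌋₊ * ((t : ℝ) * (t + 1)) ^ ⌊2 / η⌋₊
          * Real.exp (1 / η) * P ^ (1 / (h : ℝ)) * (smoothSet P R).card) ^ (m' + 1)
        * ((t * k : ℕ) : ℝ) ^ t * ((smoothSet P R).card : ℝ) ^ t)
      ((8 / 3 : ℝ) * ((k : ℝ) ^ t) ^ ⌊2 / ((h : ℝ) * η) + 2⌋₊ * ((smoothSet P R).card : ℝ) ^ t
        * (∑ q ∈ Qrange R ⌊P ^ (1 / (h : ℝ))⌋₊,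
            (Jinc k (m' + 1) (Bq P R q) h k : ℝ) ^ (1 / (2 * ((m' : ℝ) + 1)))) ^ (2 * (m' + 1))) := by
  classical
  -- names
  set C := smoothSet P R with hCdef
  set B : Finset ℤ := C.map Nat.castEmbedding with hBdef
  set Q : ℝ := P ^ (1 / (h : ℝ)) with hQdef
  set Qn : ℕ := ⌊Q⌋₊ with hQndef
  set N₀ : ℕ := ⌊2 / η⌋₊ with hN₀
  set N₁ : ℕ := ⌊2 / ((h : ℝ) * η) + 2⌋₊ with hN₁
  set S₀ : ℝ := (Jinc k (t + (m' + 1)) B h k : ℝ) with hS₀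
  have hP0 : 0 < P := by linarith
  have hm1 : 1 ≤ m' + 1 := by omega
  have hm0 : (0 : ℝ) < ((m' + 1 : ℕ) : ℝ) := by positivity
  have hmR : ((m' + 1 : ℕ) : ℝ) = (m' : ℝ) + 1 := by push_cast; ring
  -- basic facts about `B`
  have hBmem : ∀ z : ℤ, z ∈ B ↔ ∃ n ∈ C, (n : ℤ) = z := by intro z; rw [hBdef, mem_map]; rfl
  have hB : ∀ z ∈ B, 1 ≤ z ∧ (z : ℝ) ≤ P := by
    intro z hz; obtain ⟨n, hn, rfl⟩ := (hBmem z).1 hz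
    have := mem_smoothSet.1 hn
    exact ⟨by exact_mod_cast this.1, by exact_mod_cast this.2.1⟩
  have hB0 : (0 : ℤ) ∉ B := fun h0 => by have := (hB 0 h0).1; omega
  have hcardB : B.card = C.card := card_map _
  have hC1 : (1 : ℝ) ≤ C.card := by
    have : (1 : ℝ) ≤ t := by exact_mod_cast ht
    nlinarith [pow_le_pow_left₀ (by norm_num : (0:ℝ) ≤ 1) this 4]
  have hCpos : (0 : ℝ) < C.card := by linarith
  have hQ1 : 1 ≤ Q := Real.one_le_rpow hP (by positivity)
  have hQn1 : 1 ≤ Qn := by rw [hQndef]; exact Nat.le_floor (by simpa using hQ1)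
  -- `S₀ = #SolS` and the diagonal lower bound
  have hS₀card : S₀ = ((SolS k h k t (m' + 1) B).card : ℝ) := by rw [hS₀, card_SolS]
  have hdiag : (C.card : ℝ) ^ (t + (m' + 1)) ≤ S₀ := by
    rw [hS₀, ← hcardB]; exact_mod_cast card_pow_le_Jinc k h k (t + (m' + 1)) B
  have hS₀pos : 0 < S₀ := lt_of_lt_of_le (by positivity) hdiag
  -- Step 1: `S₂ ≤ S₀ / 4`
  have hS2 : (((SolS k h k t (m' + 1) B).filter fun p =>
      ¬ (Function.Injective p.1.1 ∧ Function.Injective p.2.1)).card : ℝ) ≤ S₀ / 4 := by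
    refine (card_Sol2_le (k := k) (h := h) (t := t) (m := m' + 1) B).trans ?_
    rw [← hS₀]
    -- `8 t² ≤ S₀^{1/(2s)}`
    set e : ℝ := 1 / (2 * ((t + (m' + 1) : ℕ) : ℝ)) with he
    have hs0 : (0 : ℝ) < ((t + (m' + 1) : ℕ) : ℝ) := by positivity
    have he0 : 0 < e := by positivity
    have hkey : 8 * (t : ℝ) ^ 2 ≤ S₀ ^ e := by
      have h1 : ((C.card : ℝ) ^ (t + (m' + 1))) ^ e ≤ S₀ ^ e := Real.rpow_le_rpow (by positivity) hdiag he0.le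
      have h2 : ((C.card : ℝ) ^ (t + (m' + 1))) ^ e = Real.sqrt C.card := by
        rw [← Real.rpow_natCast, ← Real.rpow_mul hCpos.le, Real.sqrt_eq_rpow]
        congr 1; rw [he]; field_simp
      have h3 : Real.sqrt (64 * (t : ℝ) ^ 4) ≤ Real.sqrt C.card := Real.sqrt_le_sqrt hC
      have h4 : Real.sqrt (64 * (t : ℝ) ^ 4) = 8 * (t : ℝ) ^ 2 := by
        rw [show (64 : ℝ) * (t : ℝ) ^ 4 = (8 * (t : ℝ) ^ 2) ^ 2 by ring, Real.sqrt_sq (by positivity)]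
      linarith
    -- `2 t² S₀^{1-e} ≤ S₀/4  ⇔  8 t² S₀^{1-e} ≤ S₀ = S₀^{1-e} S₀^e`
    have hsplit : S₀ = S₀ ^ (1 - e) * S₀ ^ e := by
      rw [← Real.rpow_add hS₀pos]; simp
    have h0 : 0 ≤ S₀ ^ (1 - e) := Real.rpow_nonneg hS₀pos.le _
    rw [le_div_iff₀ (by norm_num : (0:ℝ) < 4)]
    calc 2 * (t : ℝ) ^ 2 * S₀ ^ (1 - e) * 4 = (8 * (t : ℝ) ^ 2) * S₀ ^ (1 - e) := by ring
      _ ≤ S₀ ^ e * S₀ ^ (1 - e) := mul_le_mul_of_nonneg_right hkey h0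
      _ = S₀ := by rw [mul_comm, ← hsplit]
  -- Step 2: `S₀ ≤ (4/3)(S₃ + S₄)`
  set S3 : ℝ := ((SolSp k h k t m' B Qn).card : ℝ) with hS3
  set S4 : ℝ := ((SolS4 k h t (m' + 1) B Qn).card : ℝ) with hS4
  have hsum : S₀ ≤ S₀ / 4 + S3 + S4 := by
    have h3 := card_SolS_le_three (k := k) (h := h) (t := t) (m' := m') B Qn
    have h3' : ((SolS k h k t (m' + 1) B).card : ℝ)
        ≤ (((SolS k h k t (m' + 1) B).filter fun p =>
              ¬ (Function.Injective p.1.1 ∧ Function.Injective p.2.1)).card : ℝ) + S3 + S4 := by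
      rw [hS3, hS4]; exact_mod_cast h3
    rw [hS₀card]
    rw [hS₀card] at hS2
    linarith
  have h43 : S₀ ≤ (8 / 3) * max S3 S4 := by
    have hmax3 : S3 ≤ max S3 S4 := le_max_left _ _
    have hmax4 : S4 ≤ max S3 S4 := le_max_right _ _
    linarith
  -- Step 3: the two cases
  rcases le_total S3 S4 with h34 | h43'
  · -- main case `S₄`
    refine le_trans ?_ (le_max_right _ _)
    have hmax : max S3 S4 = S4 := max_eq_right h34
    rw [hmax] at h43
    refine h43.trans ?_
    rw [mul_assoc, mul_assoc]
    refine mul_le_mul_of_nonneg_left ?_ (by norm_num)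
    -- `S₄ ≤ (∑ W^{1/2m})^{2m} ≤ …`
    have hS4le : S4 ≤ (∑ q ∈ Qrange R Qn, (Wcount k h t (m' + 1) B q (Bq P R q) : ℝ)
          ^ (1 / (2 * ((m' + 1 : ℕ) : ℝ)))) ^ (2 * (m' + 1)) :=
      card_Sol4_le_pow (k := k) (h := h) (t := t) (m := m' + 1) (P := P) (R := R) hm1 hQn1
    refine hS4le.trans ?_
    -- bound each `W(q)`
    set c : ℝ := (C.card : ℝ) ^ t * ((k : ℝ) ^ t) ^ N₁ with hc
    have hc0 : 0 ≤ c := by positivity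
    have hWq : ∀ q ∈ Qrange R Qn, (Wcount k h t (m' + 1) B q (Bq P R q) : ℝ)
        ≤ c * (Jinc k (m' + 1) (Bq P R q) h k : ℝ) := by
      intro q hq
      have hq' := mem_Qrange.1 hq
      have hq0 : q ≠ 0 := by omega
      have hqk : ∀ p ∈ q.primeFactors, k < p := by
        intro p hp
        have := hq'.2 p hp
        exact_mod_cast hkR.trans this
      have hω := card_primeFactors_le_of_mem_Qrange hP hη hR hh hq
      have hPq : P < (q : ℝ) ^ h := by
        have h1 : Q < q := by
          have := Nat.lt_floor_add_one Q
          calc Q < (⌊Q⌋₊ : ℝ) + 1 := this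
            _ ≤ q := by exact_mod_cast (show Qn + 1 ≤ q by omega)
        have h2 : Q ^ h = P := by
          rw [hQdef, ← Real.rpow_natCast, ← Real.rpow_mul hP0.le]
          have : 1 / (h : ℝ) * (h : ℕ) = 1 := by field_simp
          rw [this, Real.rpow_one]
        calc P = Q ^ h := h2.symm
          _ < (q : ℝ) ^ h := pow_lt_pow_left₀ h1 (by linarith) (by omega)
      have := Wcount_le (k := k) (h := h) (t := t) (m := m' + 1) (B := B) (Bq := Bq P R q) hh hk hq0 hqk hω hPq hB
      calc (Wcount k h t (m' + 1) B q (Bq P R q) : ℝ)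
          ≤ (((tuples t B).card * (k ^ t) ^ N₁ * Jinc k (m' + 1) (Bq P R q) h k : ℕ) : ℝ) := by exact_mod_cast this
        _ = c * (Jinc k (m' + 1) (Bq P R q) h k : ℝ) := by
            rw [card_tuples, hcardB, hc]; push_cast; ring
    set ee : ℝ := 1 / (2 * ((m' + 1 : ℕ) : ℝ)) with hee
    have he0 : 0 ≤ ee := by positivity
    calc (∑ q ∈ Qrange R Qn, (Wcount k h t (m' + 1) B q (Bq P R q) : ℝ) ^ ee) ^ (2 * (m' + 1))
        ≤ (∑ q ∈ Qrange R Qn, (c * (Jinc k (m' + 1) (Bq P R q) h k : ℝ)) ^ ee) ^ (2 * (m' + 1)) := by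
          refine pow_le_pow_left₀ (sum_nonneg fun q _ => Real.rpow_nonneg (Nat.cast_nonneg _) _)
            (sum_le_sum fun q hq => Real.rpow_le_rpow (Nat.cast_nonneg _) (hWq q hq) he0) _
      _ = (c ^ ee * ∑ q ∈ Qrange R Qn, (Jinc k (m' + 1) (Bq P R q) h k : ℝ) ^ ee) ^ (2 * (m' + 1)) := by
          rw [mul_sum]
          congr 1
          exact sum_congr rfl fun q _ => Real.mul_rpow hc0 (Nat.cast_nonneg _)
      _ = c * (∑ q ∈ Qrange R Qn, (Jinc k (m' + 1) (Bq P R q) h k : ℝ) ^ ee) ^ (2 * (m' + 1)) := by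
          rw [mul_pow, ← Real.rpow_natCast (c ^ ee), ← Real.rpow_mul hc0]
          have : ee * ((2 * (m' + 1) : ℕ) : ℝ) = 1 := by rw [hee]; push_cast; field_simp
          rw [this, Real.rpow_one]
      _ = ((k : ℝ) ^ t) ^ N₁ * ((C.card : ℝ) ^ t
            * (∑ q ∈ Qrange R Qn, (Jinc k (m' + 1) (Bq P R q) h k : ℝ) ^ (1 / (2 * ((m' : ℝ) + 1)))) ^ (2 * (m' + 1))) := by
          rw [hc, hee, hmR]; ring
  · -- case `S₃`
    refine le_trans ?_ (le_max_left _ _)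
    have hmax : max S3 S4 = S3 := max_eq_left h43'
    rw [hmax] at h43
    -- `S₃ ≤ 2m N₃ ≤ 2m S3count`
    have hS3le : S3 ≤ 2 * ((m' + 1 : ℕ) : ℝ) * (S3count k h k t m' B C (smoothSet Q R) ⌊P⌋₊ : ℝ) := by
      have h1 := card_SolSp_le (k := k) (h := h) (g := k) (t := t) (m' := m') (B := B) (Qn := Qn)
      have h2 : N3count k h k t m' B Qn ≤ S3count k h k t m' B C (smoothSet Q R) ⌊P⌋₊ :=
        N3count_le_S3count (k := k) (h := h) (g := k) (t := t) (m' := m') (P := P) (R := R) (Q := Q)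
          (by positivity)
      rw [hS3]
      calc ((SolSp k h k t m' B Qn).card : ℝ) ≤ ((2 * (m' + 1) * N3count k h k t m' B Qn : ℕ) : ℝ) := by
            exact_mod_cast h1
        _ ≤ ((2 * (m' + 1) * S3count k h k t m' B C (smoothSet Q R) ⌊P⌋₊ : ℕ) : ℝ) := by
            exact_mod_cast Nat.mul_le_mul_left _ h2
        _ = _ := by push_cast; ring
    -- the core bound
    set KD : ℝ := Q * 2 ^ N₀ * ((C.card : ℝ) * 2 ^ N₀) with hKD
    set Gmax : ℝ := ((t : ℝ) * (t + 1)) ^ N₀ * Real.exp (1 / η) with hGmax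
    have hKD0 : 0 ≤ KD := by positivity
    have hG0 : 0 ≤ Gmax := by positivity
    have hKDle : ∑ g' ∈ Gset C, (((DWg C (smoothSet Q R) ⌊P⌋₊ g').card : ℝ)) ^ 2 ≤ KD :=
      sum_card_DWg_sq_le (Q := Q) hP hη hR (by positivity)
    have hGmaxle : ∀ x ∈ tuplesInj t B, ((((Gset C).filter fun g' => g' ∣ JN x).card : ℕ) : ℝ) ≤ Gmax := by
      intro x hx
      rw [tuplesInj, mem_filter] at hx
      have hxi : ∀ i, 1 ≤ x i ∧ (x i : ℝ) ≤ P := fun i => hB _ ((mem_tuples.1 hx.1) i)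
      have hJ0 : JN x ≠ 0 := by
        rw [JN]; exact Int.natAbs_ne_zero.2 (Jstar_ne_zero hx.2 fun i h0 => by have := (hxi i).1; omega)
      exact card_rad_dvd_le hP hη hR ht hJ0 (JN_le hP hxi)
    have hcore := S3_core_sq_le (k := k) (h := h) (g := k) (t := t) (B := B) (C := C)
      (D := smoothSet Q R) (Pn := ⌊P⌋₊) m' hKD0 hKDle hG0 hGmaxle
    -- `J_t ≤ (tk)^t |C|^t`
    have hJt : (Jinc k t B h k : ℝ) ≤ ((t * k : ℕ) : ℝ) ^ t * (C.card : ℝ) ^ t := by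
      have := Jinc_diag_le hh hk B hB0
      rw [hcardB] at this
      exact_mod_cast this
    -- assemble: `S₀ ≤ (16m/3) S3count`, square, divide by `S₀^{2-1/m}`
    set M : ℝ := ((m' + 1 : ℕ) : ℝ) with hMdef
    have hM0 : 0 < M := hm0
    set A : ℝ := (16 * M / 3) ^ 2 * KD * Gmax with hA
    have hA0 : 0 ≤ A := by positivity
    set X : ℝ := (S3count k h k t m' B C (smoothSet Q R) ⌊P⌋₊ : ℝ) with hX
    have hX0 : 0 ≤ X := Nat.cast_nonneg _
    have hS0X : S₀ ≤ 16 * M / 3 * X := by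
      calc S₀ ≤ 8 / 3 * S3 := h43
        _ ≤ 8 / 3 * (2 * M * X) := by rw [hX]; exact mul_le_mul_of_nonneg_left hS3le (by norm_num)
        _ = 16 * M / 3 * X := by ring
    set Jt : ℝ := (Jinc k t B h k : ℝ) with hJtdef
    have hJt0 : 0 ≤ Jt := Nat.cast_nonneg _
    have hsq : S₀ ^ 2 ≤ A * Jt ^ (1 / M) * S₀ ^ (2 - 1 / M) := by
      have hcore' : X ^ 2 ≤ KD * Gmax * Jt ^ (1 / M) * S₀ ^ (2 - 1 / M) := by
        rw [hMdef]; push_cast; exact hcore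
      calc S₀ ^ 2 ≤ (16 * M / 3 * X) ^ 2 := pow_le_pow_left₀ hS₀pos.le hS0X 2
        _ = (16 * M / 3) ^ 2 * X ^ 2 := by ring
        _ ≤ (16 * M / 3) ^ 2 * (KD * Gmax * Jt ^ (1 / M) * S₀ ^ (2 - 1 / M)) :=
            mul_le_mul_of_nonneg_left hcore' (by positivity)
        _ = A * Jt ^ (1 / M) * S₀ ^ (2 - 1 / M) := by rw [hA]; ring
    -- divide: `S₀^{1/m} ≤ A Jt^{1/m}`
    have hroot : S₀ ^ (1 / M) ≤ A * Jt ^ (1 / M) := by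
      have hpos : 0 < S₀ ^ (2 - 1 / M) := Real.rpow_pos_of_pos hS₀pos _
      have e : S₀ ^ 2 = S₀ ^ (1 / M) * S₀ ^ (2 - 1 / M) := by
        rw [← Real.rpow_add hS₀pos, ← Real.rpow_natCast]; congr 1; push_cast; ring
      rw [e] at hsq
      exact le_of_mul_le_mul_right hsq hpos
    -- raise to the power `m`
    have hfinal : S₀ ≤ A ^ (m' + 1) * Jt := by
      have h1 : (S₀ ^ (1 / M)) ^ (m' + 1) ≤ (A * Jt ^ (1 / M)) ^ (m' + 1) :=
        pow_le_pow_left₀ (Real.rpow_nonneg hS₀pos.le _) hroot (m' + 1)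
      have hMe : 1 / M * ((m' + 1 : ℕ) : ℝ) = 1 := by rw [hMdef]; field_simp
      have e1 : (S₀ ^ (1 / M)) ^ (m' + 1) = S₀ := by
        rw [← Real.rpow_natCast, ← Real.rpow_mul hS₀pos.le, Nat.cast_add, Nat.cast_one, ← hmR, hMe, Real.rpow_one]
      have e2 : (A * Jt ^ (1 / M)) ^ (m' + 1) = A ^ (m' + 1) * Jt := by
        rw [mul_pow, ← Real.rpow_natCast (Jt ^ (1 / M)), ← Real.rpow_mul hJt0, Nat.cast_add, Nat.cast_one,
          ← hmR, hMe, Real.rpow_one]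
      rw [e1, e2] at h1; exact h1
    refine hfinal.trans ?_
    have h4 : (4 : ℝ) ^ N₀ = 2 ^ N₀ * 2 ^ N₀ := by rw [← mul_pow]; norm_num
    calc A ^ (m' + 1) * Jt ≤ A ^ (m' + 1) * (((t * k : ℕ) : ℝ) ^ t * (C.card : ℝ) ^ t) :=
          mul_le_mul_of_nonneg_left hJt (by positivity)
      _ = _ := by
          rw [hA, hKD, hGmax, hMdef, h4]
          push_cast
          ring

end Assembly

end FordVK
end Literature.NumberTheory.LFunctions
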